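/-
Copyright: the b2b-balaban T⁴-continuum CRUX team, row NE7b OWNER lineage `t4-ne7b-p1` (gen 110). Project licence.
-/
import Mathlib.Analysis.Convex.Strong
import Mathlib.Analysis.InnerProductSpace.Basic

/-!
# THE CONVEXITY MODULUS OF ONE FLUCTUATION STEP, BY VALUE: for `U(ψ, φ) = V(φ) + G(ψ − Qφ)` with `V` `σ`-convex, `G` `a`-convex and
# `‖Q‖ ≤ κ`, the JOINT exponent is `aσ∕(σ + aκ²)`-convex in the kept variable `ψ` uniformly along the fibres — the hypothesis `hVc` of
# `…LogConcaveMarginal` §3 SUPPLIED for the renormalisation-step form, SHARP (row NE7b, node U5c; residual (R2′) family (2), letter (ℓ1))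

Cell `pub-balaban`, sub-cell `t4`, spine estimate NE7b (`T4WeightBudget.RelWeightBound`; the cell's OWN estimate — NOT PRINTED in
[Bałaban 1983–89], NOT PROVED).  Crux-route work under `Spine/NE7b/` by the row's OWNER; NOTHING of Bałaban's is named or asserted; no
`T4Continuum/Support` leaf typed; no `def`; zero `sorry`.  Imports: Mathlib only (independent of the hub's olean frontier).

WHY.  The OWNER's `…LogConcaveMarginal` §3 (`strongConvexOn_neg_log_fibreIntegral`, Brascamp–Lieb 1976 Thm 4.3 on a convex window) lets
the marginal exponent `ψ ↦ −log ∫_{K_ψ} e^{−U(ψ,φ)} dφ` INHERIT a modulus `λ` — provided the JOINT exponent `U` obeys the secant letter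
`U(t p + s q) + (λ∕2)·t·s·‖q₁ − p₁‖² ≤ t U(p) + s U(q)` on the window (its hypothesis `hVc`): `λ`-convexity in the KEPT direction,
uniformly along the integrated one.  A renormalisation step does not hand over an exponent of that shape with `λ` displayed: it hands
over `U(ψ, φ) = V(φ) + G(ψ − Qφ)` — the current action `V` of the old field `φ` (modulus `σ` ON its window `K₂`), plus the fluctuation
weight `G` (for a Gaussian step `G = (a∕2)‖·‖²`, modulus `a`) evaluated at the new field MINUS an averaging `Q` of the old one
(`‖Qφ‖ ≤ κ‖φ‖`).  Neither summand is convex in `ψ` uniformly in `φ` with a useful constant by itself (`V` does not see `ψ`; `G(ψ − Qφ)`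
is `a`-convex in `ψ` but the cross term couples).  THIS FILE computes the joint letter BY VALUE from the three numbers: the modulus in
the kept direction is the PARALLEL SUM `aσ∕(σ + aκ²)` (`= (a⁻¹ + κ²σ⁻¹)⁻¹` when `a, σ > 0`), and it is SHARP (attained by the Gaussian
pair, §3).  In form currency this is the Schur complement of the joint block form `[[a, −aQ], [−aQ†, σ + aQ†Q]]` bounded below by a
scalar (`…ConvexityModulusSchur` §4 ∕ §6 is the general Schur step; this file is its by-value instance for the step form, proved
directly — no fibre minimiser, no invertibility, no finite dimension, `σ = 0` or `a = 0` allowed).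

WHAT IS PROVED ([folklore] convex algebra; Mathlib only):
* §1 `parallelSum_identity` ((s+a)(s‖w‖² + a‖v−w‖²) − s·a·‖v‖² = ‖s•w − a•(v−w)‖²), **`parallelSum_le`** (`(s·a∕(s+a))‖v‖² ≤ s‖w‖² +
  a‖v − w‖²` for `s + a > 0`), **`stepForm_le`** (`(aσ∕(σ+aκ²))‖v‖² ≤ σ‖y‖² + a‖v − w‖²` whenever `‖w‖ ≤ κ‖y‖`; `σ ≥ 0`, ANY real
  `a`, `σ + aκ² > 0`; `y` in any normed group).
* §2 **`secant_base_of_fluctuationStep`** — THE STEP's JOINT LETTER: `G` `a`-strongly convex on `K₁ ⊆ E₁` (real inner product space),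
  `V` `σ`-strongly convex on `K₂ ⊆ E₂` (real normed space), `Q : E₂ →ₗ E₁` with `‖Qφ‖ ≤ κ‖φ‖`, `U p = V p.2 + G (p.1 − Q p.2)`, and a
  set `K ⊆ E₁ × E₂` whose points have `p.2 ∈ K₂`, `p.1 − Q p.2 ∈ K₁` ⟹ for `p, q ∈ K`, `t, s ≥ 0`, `t + s = 1`:
  `U(t p + s q) + (aσ∕(σ+aκ²))∕2·t·s·‖q.1 − p.1‖² ≤ t U p + s U q` — VERBATIM the shape of `…LogConcaveMarginal` §3's `hVc` (there
  `E₁ × E₂ = ℝᵐ × ℝⁿ`); `secant_base_of_fluctuationStep_prod` (the product window `B ×ˢ K₂`, `G` convex on all of `E₁`);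
  `strongConvexOn_slice` (for the record: each slice `ψ ↦ U(ψ, φ)` at a fixed old field is `a`-convex — the fibre share, NOT what the
  marginal consumes).
* §3 SHARPNESS (the Gaussian pair): `stepForm_at_minimiser` — at `φ⋆ = (aκ∕(σ+aκ²))•ψ`,
  `(σ∕2)‖φ⋆‖² + (a∕2)‖ψ − κ•φ⋆‖² = (aσ∕(σ+aκ²))∕2·‖ψ‖²`: with `V = (σ∕2)‖·‖²`, `G = (a∕2)‖·‖²`, `Q = κ•id` the fibrewise infimum of the
  joint modulus form IS the displayed constant, so no larger modulus survives in general.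
* §4 ARITHMETIC OF THE STEP MAP `σ ↦ aσ∕(σ + aκ²)` (for towers): `stepModulus_nonneg`, `stepModulus_le_fluct` (`≤ a`),
  `stepModulus_le_transported` (`≤ σ∕κ²` for `κ ≠ 0`), `stepModulus_mono` (monotone in `σ`), `stepModulus_mono_fluct` (monotone in `a`)
  — so a lower bound on the incoming modulus propagates: iterate with `…ConvexityModulusTransport.strongConvexOn_comp_smul` (rescaling
  `ψ ↦ c•ψ` multiplies the modulus by `c²`) between steps.

NOT HERE (honest): which `V`, `G`, `Q`, windows and numbers `(σ, a, κ)` Bałaban's steps display, in which chart ((A3) ∕ (A1c) readings —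
NC-NE7b-α UNRULED; by the refuter's F463 the letter by value is closed in the RT chart only); the marginal itself (`…LogConcaveMarginal`
§3 ∕ §6, joined BY SHAPE); the form-currency (anisotropic) version (`…ConvexityModulusSchur`); anything of Bałaban's.  BY-NAME EFFECT ON
THE WALL: NONE.  NE7b NOT PRINTED ∕ NOT PROVED; spine PROVED 0∕9; rung (B)+1 on a FINITE torus — NOT infinite volume, NOT the mass gap,
NOT Clay.  HONEST DEPENDENCY: continuum YM on T⁴ ⇐ BetaPertH ∧ nine spine estimates (0/9 proved); BetaPertH ⇐ (D1) ∧ (D4) ∧ CAP+tail.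
-/

set_option autoImplicit false

noncomputable section

open Set
open scoped RealInnerProductSpace

namespace Summit.QuantumFields.BalabanUV.T4Continuum.NE7b.FluctuationStepModulus

/-! ## §1 The parallel-sum inequality -/

section ParallelSum

variable {E : Type*} [NormedAddCommGroup E] [InnerProductSpace ℝ E]

/-- Completing the square: `(s + a)(s‖w‖² + a‖v − w‖²) − s·a·‖v‖² = ‖s•w − a•(v − w)‖²` in a real inner product space. [folklore] -/
theorem parallelSum_identity (s a : ℝ) (v w : E) :
    (s + a) * (s * ‖w‖ ^ 2 + a * ‖v - w‖ ^ 2) - s * a * ‖v‖ ^ 2 = ‖s • w - a • (v - w)‖ ^ 2 := by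
  simp only [← real_inner_self_eq_norm_sq, inner_sub_left, inner_sub_right, real_inner_smul_left, real_inner_smul_right,
    real_inner_comm v w]
  ring

/-- **THE PARALLEL-SUM INEQUALITY**: `(s·a∕(s + a))·‖v‖² ≤ s·‖w‖² + a·‖v − w‖²` for `s + a > 0` and all `v, w` (the infimum over `w`
of the right-hand side is the left-hand side when `s, a ≥ 0`: two springs in series). [folklore] -/
theorem parallelSum_le {s a : ℝ} (hsa : 0 < s + a) (v w : E) :
    s * a / (s + a) * ‖v‖ ^ 2 ≤ s * ‖w‖ ^ 2 + a * ‖v - w‖ ^ 2 := by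
  rw [div_mul_eq_mul_div, div_le_iff₀ hsa]
  have h := parallelSum_identity s a v w
  nlinarith [sq_nonneg ‖s • w - a • (v - w)‖]

/-- **THE FLUCTUATION-STEP FORM INEQUALITY**: for `σ ≥ 0` and ANY real `a` with `σ + aκ² > 0`, `v, w` in a real inner product space
and `y` in any normed group with `‖w‖ ≤ κ‖y‖` (think `w = Q y`, `‖Q‖ ≤ κ`):
`(aσ∕(σ + aκ²))·‖v‖² ≤ σ·‖y‖² + a·‖v − w‖²` (a SEMIconvex fluctuation weight `a < 0` is allowed when `σ > |a|κ²`). [folklore] -/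
theorem stepForm_le {F : Type*} [NormedAddCommGroup F] {σ a κ : ℝ} (hσ : 0 ≤ σ) (hD : 0 < σ + a * κ ^ 2)
    (v w : E) (y : F) (hw : ‖w‖ ≤ κ * ‖y‖) :
    a * σ / (σ + a * κ ^ 2) * ‖v‖ ^ 2 ≤ σ * ‖y‖ ^ 2 + a * ‖v - w‖ ^ 2 := by
  rcases le_or_gt κ 0 with hκ | hκ
  · -- `κ ≤ 0` forces `w = 0`
    have hw0 : w = 0 := by
      have : ‖w‖ ≤ 0 := hw.trans (mul_nonpos_of_nonpos_of_nonneg hκ (norm_nonneg y))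
      exact norm_le_zero_iff.1 this
    subst hw0
    rw [sub_zero]
    have h1 : a * σ / (σ + a * κ ^ 2) ≤ a := by
      rw [div_le_iff₀ hD]
      nlinarith [sq_nonneg (a * κ)]
    nlinarith [sq_nonneg ‖v‖, sq_nonneg ‖y‖, mul_nonneg hσ (sq_nonneg ‖y‖)]
  · -- `κ > 0`: reduce to the parallel sum with `s = σ∕κ²`
    have hκ2 : 0 < κ ^ 2 := by positivity
    have hwy : ‖w‖ ^ 2 ≤ κ ^ 2 * ‖y‖ ^ 2 := by
      rw [← mul_pow]
      exact pow_le_pow_left₀ (norm_nonneg w) hw 2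
    have hs : 0 < σ / κ ^ 2 + a := by
      have : σ / κ ^ 2 + a = (σ + a * κ ^ 2) / κ ^ 2 := by field_simp
      rw [this]; positivity
    have key := parallelSum_le hs v w
    have e : σ / κ ^ 2 * a / (σ / κ ^ 2 + a) = a * σ / (σ + a * κ ^ 2) := by
      rw [div_eq_div_iff hs.ne' hD.ne']
      field_simp
    rw [e] at key
    have h2 : σ / κ ^ 2 * ‖w‖ ^ 2 ≤ σ * ‖y‖ ^ 2 := by
      rw [div_mul_eq_mul_div, div_le_iff₀ hκ2]
      nlinarith [mul_le_mul_of_nonneg_left hwy hσ]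
    linarith

end ParallelSum

/-! ## §2 The joint secant letter of the fluctuation-step exponent `U(ψ, φ) = V(φ) + G(ψ − Qφ)` -/

section Step

variable {E₁ : Type*} [NormedAddCommGroup E₁] [InnerProductSpace ℝ E₁]
variable {E₂ : Type*} [NormedAddCommGroup E₂] [NormedSpace ℝ E₂]

/-- **THE CONVEXITY MODULUS OF ONE FLUCTUATION STEP, BY VALUE.**  Let `G : E₁ → ℝ` be `a`-strongly convex on `K₁` (the fluctuation
weight; `E₁` a real inner product space), `V : E₂ → ℝ` be `σ`-strongly convex on `K₂` (the incoming action; `E₂` a real normed space),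
`Q : E₂ →ₗ[ℝ] E₁` an averaging with `‖Qφ‖ ≤ κ‖φ‖`, `σ ≥ 0`, `σ + aκ² > 0` (`a` any real), and `U p = V p.2 + G (p.1 − Q p.2)` the step's JOINT
exponent on `E₁ × E₂`.  On any `K ⊆ E₁ × E₂` whose points satisfy `p.2 ∈ K₂` and `p.1 − Q p.2 ∈ K₁`:
`U(t•p + s•q) + (aσ∕(σ+aκ²))∕2 · t · s · ‖q.1 − p.1‖² ≤ t·U p + s·U q` for `p, q ∈ K`, `t, s ≥ 0`, `t + s = 1` — the exponent is
`aσ∕(σ + aκ²)`-convex in the KEPT variable uniformly along the fibres: VERBATIM the hypothesis `hVc` of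
`…LogConcaveMarginal.strongConvexOn_neg_log_fibreIntegral` (Brascamp–Lieb Thm 4.3 on a convex window) for the step form. [folklore] -/
theorem secant_base_of_fluctuationStep {K₁ : Set E₁} {K₂ : Set E₂} {G : E₁ → ℝ} {V : E₂ → ℝ} {a σ κ : ℝ}
    (hG : StrongConvexOn K₁ a G) (hV : StrongConvexOn K₂ σ V) (hσ : 0 ≤ σ) (hD : 0 < σ + a * κ ^ 2)
    (Q : E₂ →ₗ[ℝ] E₁) (hQ : ∀ y, ‖Q y‖ ≤ κ * ‖y‖) {U : E₁ × E₂ → ℝ} (hU : ∀ p, U p = V p.2 + G (p.1 - Q p.2))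
    {K : Set (E₁ × E₂)} (hK₂ : ∀ p ∈ K, p.2 ∈ K₂) (hK₁ : ∀ p ∈ K, p.1 - Q p.2 ∈ K₁) :
    ∀ p ∈ K, ∀ q ∈ K, ∀ t s : ℝ, 0 ≤ t → 0 ≤ s → t + s = 1 →
      U (t • p + s • q) + a * σ / (σ + a * κ ^ 2) / 2 * t * s * ‖q.1 - p.1‖ ^ 2 ≤ t * U p + s * U q := by
  intro p hp q hq t s ht hs hts
  -- the two strong-convexity inequalities
  have h2 := hV.2 (hK₂ p hp) (hK₂ q hq) ht hs hts
  have h1 := hG.2 (hK₁ p hp) (hK₁ q hq) ht hs hts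
  simp only [smul_eq_mul] at h1 h2
  -- the interpolant's components
  have e2 : (t • p + s • q).2 = t • p.2 + s • q.2 := by simp
  have e1 : (t • p + s • q).1 - Q (t • p + s • q).2 = t • (p.1 - Q p.2) + s • (q.1 - Q q.2) := by
    simp only [Prod.fst_add, Prod.smul_fst, Prod.snd_add, Prod.smul_snd, map_add, map_smul, smul_sub]
    abel
  have e3 : p.1 - Q p.2 - (q.1 - Q q.2) = (p.1 - q.1) - Q (p.2 - q.2) := by
    rw [map_sub]; abel
  rw [hU, hU p, hU q, e1, e2]
  rw [e3] at h1
  -- the step-form inequality on the difference vector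
  have key := stepForm_le hσ hD (p.1 - q.1) (Q (p.2 - q.2)) (p.2 - q.2) (hQ _)
  have hts0 : 0 ≤ t * s := mul_nonneg ht hs
  have key' := mul_le_mul_of_nonneg_left key hts0
  rw [norm_sub_rev q.1 p.1]
  nlinarith [key', h1, h2]

/-- **THE PRODUCT-WINDOW CASE** (the fluctuation weight convex on all of `E₁`, e.g. a Gaussian; the incoming action windowed to a convex
`K₂`): on `K = B ×ˢ K₂` the step exponent `U p = V p.2 + G (p.1 − Q p.2)` obeys `…LogConcaveMarginal` §3's `hVc` with
`λ = aσ∕(σ + aκ²)`. [folklore] -/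
theorem secant_base_of_fluctuationStep_prod {K₂ : Set E₂} {G : E₁ → ℝ} {V : E₂ → ℝ} {a σ κ : ℝ}
    (hG : StrongConvexOn univ a G) (hV : StrongConvexOn K₂ σ V) (hσ : 0 ≤ σ) (hD : 0 < σ + a * κ ^ 2)
    (Q : E₂ →ₗ[ℝ] E₁) (hQ : ∀ y, ‖Q y‖ ≤ κ * ‖y‖) {U : E₁ × E₂ → ℝ} (hU : ∀ p, U p = V p.2 + G (p.1 - Q p.2))
    (B : Set E₁) :
    ∀ p ∈ B ×ˢ K₂, ∀ q ∈ B ×ˢ K₂, ∀ t s : ℝ, 0 ≤ t → 0 ≤ s → t + s = 1 →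
      U (t • p + s • q) + a * σ / (σ + a * κ ^ 2) / 2 * t * s * ‖q.1 - p.1‖ ^ 2 ≤ t * U p + s * U q :=
  secant_base_of_fluctuationStep hG hV hσ hD Q hQ hU (fun _ hp => (mem_prod.1 hp).2) fun _ _ => mem_univ _

/-- The SLICE at a fixed old field: `ψ ↦ U(ψ, φ) = V φ + G(ψ − Qφ)` is `a`-strongly convex on `{ψ | ψ − Qφ ∈ K₁}` whenever `G` is
`a`-strongly convex on a convex `K₁` (translation of a strongly convex function; the fibre share of the letter, for the record — the
marginal consumes the JOINT letter above, not this). [folklore] -/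
theorem strongConvexOn_slice {K₁ : Set E₁} {G : E₁ → ℝ} {a : ℝ} (hG : StrongConvexOn K₁ a G) (Q : E₂ →ₗ[ℝ] E₁)
    (V : E₂ → ℝ) (φ : E₂) :
    StrongConvexOn ((fun ψ : E₁ => ψ - Q φ) ⁻¹' K₁) a fun ψ => V φ + G (ψ - Q φ) := by
  have e : ∀ (x y : E₁) (t s : ℝ), t + s = 1 → t • x + s • y - Q φ = t • (x - Q φ) + s • (y - Q φ) := by
    intro x y t s hts
    rw [smul_sub, smul_sub, ← add_sub_add_comm, ← add_smul, hts, one_smul]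
  refine ⟨?_, fun x hx y hy t s ht hs hts => ?_⟩
  · intro x hx y hy t s ht hs hts
    simp only [mem_preimage] at hx hy ⊢
    rw [e x y t s hts]
    exact hG.1 hx hy ht hs hts
  · have h := hG.2 hx hy ht hs hts
    have e' : x - Q φ - (y - Q φ) = x - y := by abel
    rw [e'] at h
    simp only [smul_eq_mul] at h ⊢
    rw [e x y t s hts]
    have hV : t * V φ + s * V φ = V φ := by rw [← add_mul, hts, one_mul]
    linarith

end Step

/-! ## §3 Sharpness: the Gaussian pair attains the constant -/

section Sharp

variable {E : Type*} [NormedAddCommGroup E] [InnerProductSpace ℝ E]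

/-- **THE CONSTANT IS ATTAINED.**  With `V = (σ∕2)‖·‖²`, `G = (a∕2)‖·‖²` and `Q = κ•id` on one inner product space, the joint modulus form
on the difference vector `(v, y)` is `(σ∕2)‖y‖² + (a∕2)‖v − κ•y‖²`, bounded below by `(aσ∕(σ+aκ²))∕2·‖v‖²` for every `y` (`stepForm_le`)
and EQUAL to it at the fibre minimiser `y⋆ = (aκ∕(σ + aκ²))•v`: the fibrewise infimum — the Schur complement of `[[a, −aκ], [−aκ, σ + aκ²]]`
— is exactly `aσ∕(σ + aκ²)`, so §2's modulus cannot be improved from the three numbers alone. [folklore] -/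
theorem stepForm_at_minimiser {σ a κ : ℝ} (hD : 0 < σ + a * κ ^ 2) (v : E) :
    σ / 2 * ‖(a * κ / (σ + a * κ ^ 2)) • v‖ ^ 2 + a / 2 * ‖v - κ • (a * κ / (σ + a * κ ^ 2)) • v‖ ^ 2 =
      a * σ / (σ + a * κ ^ 2) / 2 * ‖v‖ ^ 2 := by
  have hD' : σ + a * κ ^ 2 ≠ 0 := hD.ne'
  have e0 : 1 - κ * (a * κ / (σ + a * κ ^ 2)) = σ / (σ + a * κ ^ 2) := by
    rw [eq_div_iff hD', sub_mul, one_mul, mul_assoc, div_mul_cancel₀ _ hD']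
    ring
  have e1 : v - κ • (a * κ / (σ + a * κ ^ 2)) • v = (σ / (σ + a * κ ^ 2)) • v := by
    rw [smul_smul, ← e0, sub_smul, one_smul]
  rw [e1, norm_smul, norm_smul, mul_pow, mul_pow, Real.norm_eq_abs, Real.norm_eq_abs, sq_abs, sq_abs]
  field_simp
  ring

/-- The lower bound half of the sharpness statement, for the same Gaussian pair: `(aσ∕(σ+aκ²))∕2·‖v‖² ≤ (σ∕2)‖y‖² + (a∕2)‖v − κ•y‖²` for
every `y` (`stepForm_le` with `w = κ•y`; `0 ≤ κ`). [folklore] -/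
theorem stepForm_half_le {σ a κ : ℝ} (hσ : 0 ≤ σ) (hκ : 0 ≤ κ) (hD : 0 < σ + a * κ ^ 2) (v y : E) :
    a * σ / (σ + a * κ ^ 2) / 2 * ‖v‖ ^ 2 ≤ σ / 2 * ‖y‖ ^ 2 + a / 2 * ‖v - κ • y‖ ^ 2 := by
  have h := stepForm_le hσ hD v (κ • y) y (by rw [norm_smul, Real.norm_eq_abs, abs_of_nonneg hκ])
  linarith

end Sharp

/-! ## §4 Arithmetic of the step map `σ ↦ aσ∕(σ + aκ²)` (for towers of steps) -/

section StepMap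

/-- The outgoing modulus is non-negative. [folklore] -/
theorem stepModulus_nonneg {σ a κ : ℝ} (hσ : 0 ≤ σ) (ha : 0 ≤ a) (hD : 0 < σ + a * κ ^ 2) :
    0 ≤ a * σ / (σ + a * κ ^ 2) :=
  div_nonneg (mul_nonneg ha hσ) hD.le

/-- The outgoing modulus never exceeds the fluctuation modulus `a` (any real `a`, `σ`). [folklore] -/
theorem stepModulus_le_fluct {σ a κ : ℝ} (hD : 0 < σ + a * κ ^ 2) :
    a * σ / (σ + a * κ ^ 2) ≤ a := by
  rw [div_le_iff₀ hD]
  nlinarith [sq_nonneg (a * κ)]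

/-- The outgoing modulus never exceeds the transported incoming modulus `σ∕κ²` (`κ ≠ 0`; any real `a`, `σ`). [folklore] -/
theorem stepModulus_le_transported {σ a κ : ℝ} (hκ : κ ≠ 0) (hD : 0 < σ + a * κ ^ 2) :
    a * σ / (σ + a * κ ^ 2) ≤ σ / κ ^ 2 := by
  have hκ2 : 0 < κ ^ 2 := by positivity
  rw [div_le_div_iff₀ hD hκ2]
  nlinarith [sq_nonneg σ]

/-- **MONOTONE IN THE INCOMING MODULUS**: `σ ≤ σ'` ⟹ `aσ∕(σ + aκ²) ≤ aσ'∕(σ' + aκ²)` (`a ≥ 0`) — a LOWER bound on the incoming modulus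
propagates through the step. [folklore] -/
theorem stepModulus_mono {σ σ' a κ : ℝ} (ha : 0 ≤ a) (hD : 0 < σ + a * κ ^ 2) (hσσ' : σ ≤ σ') :
    a * σ / (σ + a * κ ^ 2) ≤ a * σ' / (σ' + a * κ ^ 2) := by
  have hD' : 0 < σ' + a * κ ^ 2 := by linarith
  rw [div_le_div_iff₀ hD hD']
  nlinarith [mul_nonneg (mul_nonneg ha ha) (sq_nonneg κ), mul_nonneg (mul_nonneg (mul_nonneg ha ha) (sq_nonneg κ)) (sub_nonneg.2 hσσ')]

/-- **MONOTONE IN THE FLUCTUATION MODULUS**: `a ≤ a'` ⟹ `aσ∕(σ + aκ²) ≤ a'σ∕(σ + a'κ²)` (`σ ≥ 0`). [folklore] -/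
theorem stepModulus_mono_fluct {σ a a' κ : ℝ} (hσ : 0 ≤ σ) (hD : 0 < σ + a * κ ^ 2) (haa' : a ≤ a') :
    a * σ / (σ + a * κ ^ 2) ≤ a' * σ / (σ + a' * κ ^ 2) := by
  have hD' : 0 < σ + a' * κ ^ 2 := by nlinarith [sq_nonneg κ, mul_le_mul_of_nonneg_right haa' (sq_nonneg κ)]
  rw [div_le_div_iff₀ hD hD']
  nlinarith [mul_nonneg hσ hσ, mul_nonneg (mul_nonneg hσ hσ) (sub_nonneg.2 haa')]

/-- **THE GAUSSIAN FIXED-POINT FORM of the step map** (`a, σ > 0`): `aσ∕(σ + aκ²) = (a⁻¹ + κ²·σ⁻¹)⁻¹` — resistances in parallel. [folklore] -/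
theorem stepModulus_eq_inv {σ a κ : ℝ} (hσ : 0 < σ) (ha : 0 < a) :
    a * σ / (σ + a * κ ^ 2) = (a⁻¹ + κ ^ 2 * σ⁻¹)⁻¹ := by
  have h1 : a⁻¹ + κ ^ 2 * σ⁻¹ = (σ + a * κ ^ 2) / (a * σ) := by
    field_simp
  rw [h1, inv_div]

end StepMap

/-! ## §5 Sanity (decided toy): the numbers of a critical Gaussian step -/

/-- Toy: `a = 1`, `σ = 1`, `κ = 1` (unit fluctuation, unit incoming modulus, norm-one averaging) gives outgoing modulus `1∕2`; after a
rescaling of the kept field by `c` with `c² = 2` the modulus is `1` again — the shape of a fixed point of «step, then rescale». -/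
example : (1 : ℝ) * 1 / (1 + 1 * 1 ^ 2) = 1 / 2 ∧ (2 : ℝ) * (1 / 2) = 1 := by norm_num

end Summit.QuantumFields.BalabanUV.T4Continuum.NE7b.FluctuationStepModulus
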